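import Literature.Computability.AlgebraicComplexity.MatrixMultiplicationExponent
import Mathlib.LinearAlgebra.Matrix.Trace
import Mathlib.Analysis.SpecialFunctions.Log.Base
import Mathlib.Order.LiminfLimsup
import HarnessLib

/-!
# The cubic `tr(A³)` and the exponent of matrix multiplication (Chiantini–Hauenstein–Ikenmeyer–
# Landsberg–Ottaviani 2018)

Topic: `Literature/Computability/AlgebraicComplexity`. Named facts for route
`MatrixMultiplication/WaringApolarity` (items `stmt-MatrixMultiplication-0616/0619/0621`), over the
definitions of `MatrixMultiplicationExponent.lean` (`tensorRank`, `matMulTensor`, `omega`).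

## Content

* `waringRankTrCube n` — the Waring (symmetric) rank `R_S(sM⟨n⟩)` of the cubic form
  `sM⟨n⟩(A) = trace(A³)` on `n × n` complex matrices: the least `r` such that
  `tr(A³) = ∑_{i<r} tr(L_i A)³` identically for some matrices `L_i` (every linear form on
  `M_n(ℂ)` is `A ↦ tr(L A)`). Written as the same `sInf` that the route's items inline, so that
  items are these facts up to unfolding. Over `ℂ` every cubic form is a finite sum of cubes of
  linear forms, so the set is non-empty and the `sInf` is a minimum (not proved here).
* `CHILO2018_omega_eq_liminf` — Thm. 1.1 (first equality): `ω = liminf_n log_n R_S(sM⟨n⟩)`.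
* `CHILO2018_waringRank_le` — Lemma 1.2 with (1.5) (proof of (1.6), p. 4):
  `R_S(sM⟨n⟩) ≤ 4·R(M⟨n⟩)` (the Waring rank of `xyz` is `4`).
* `CHILO2018_rank_le_waringRank` — p. 5 (proof of (1.6)): `R(M⟨n⟩) ≤ R(sM⟨3n⟩) ≤ R_S(sM⟨3n⟩)`
  via the block matrix `X(A,B,C)` with `tr(X³) = 3 tr(ABC)`.
* `CHILO2018_waringRank_two` — Thm. 1.3(1): `R_S(sM⟨2⟩) = 6`.
  (Also in print, NOT vendored: border rank `bR_S(sM⟨2⟩) = 5`; `bR_S(sM⟨3⟩) ≥ 14` (Prop. 2.6,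
  Young flattening); `R_S(sM⟨3⟩) ≤ 18` is only a numerical "Theorem* 1.4", with Conj. 2.8
  `R_S(sM⟨3⟩) = 18`.)

## Source

* L. Chiantini, J. D. Hauenstein, C. Ikenmeyer, J. M. Landsberg, G. Ottaviani, *Polynomials and
  the exponent of matrix multiplication*, Bull. LMS 50 (2018), arXiv:1706.05074: Thm. 1.1,
  Lemma 1.2, Thm. 1.3, §2 (p. 4–5), Prop. 2.6, Thm* 1.4/2.7, Conj. 2.8.
-/

noncomputable section

open scoped BigOperators
open Filter

namespace Literature.Computability.AlgebraicComplexity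

/-- The **Waring rank of `tr(A³)` on `M_n(ℂ)`**, `R_S(sM⟨n⟩)`: least `r` with
`tr(A³) = ∑_{i<r} tr(L_i A)³` for all `A` (Chiantini et al. 2018, §1: symmetric rank of the
symmetrised matrix multiplication tensor `sM⟨n⟩`, whose polynomial is `A ↦ trace(A³)`).
[cite: ChiantiniHauensteinIkenmeyerLandsbergOttaviani2018, §1 (sM⟨n⟩ and R_S)] -/
def waringRankTrCube (n : ℕ) : ℕ :=
  sInf {r : ℕ | ∃ (L : Fin r → Matrix (Fin n) (Fin n) ℂ), ∀ A : Matrix (Fin n) (Fin n) ℂ,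
    (A ^ 3).trace = ∑ i, ((L i * A).trace) ^ 3}

/-- NAMED FACT — **the exponent of matrix multiplication is computed by the Waring rank of
`tr(A³)`** (Chiantini et al. 2018, Thm. 1.1, first equality: `ω = liminf_{n} log_n R_S(sM⟨n⟩)`).
Users take `(h : CHILO2018_omega_eq_liminf)`.
[cite: ChiantiniHauensteinIkenmeyerLandsbergOttaviani2018, Thm. 1.1] -/
def CHILO2018_omega_eq_liminf : Prop :=
  Filter.liminf (fun n : ℕ => Real.logb n (waringRankTrCube n : ℝ)) atTop = omega ℂ

/-- NAMED FACT — `R_S(sM⟨n⟩) ≤ 4 · R(M⟨n⟩)` (Chiantini et al. 2018, Lemma 1.2 with (1.5), used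
in the proof of (1.6), p. 4: "`4R(M⟨n⟩) ≥ R_S(sM⟨n⟩)`"; the Waring rank of `xyz` is `4`).
Users take `(h : CHILO2018_waringRank_le)`.
[cite: ChiantiniHauensteinIkenmeyerLandsbergOttaviani2018, Lemma 1.2] -/
def CHILO2018_waringRank_le : Prop :=
  ∀ n : ℕ, waringRankTrCube n ≤ 4 * tensorRank (matMulTensor ℂ n n n)

/-- NAMED FACT — **polarisation bridge** `R(M⟨n⟩) ≤ R_S(sM⟨3n⟩)` (Chiantini et al. 2018, p. 5,
proof of (1.6): for the `3n × 3n` block matrix `X(A,B,C)` one has `trace(X³) = 3 trace(ABC)`,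
whence `R(M⟨n⟩) ≤ R(sM⟨3n⟩)`, and `R ≤ R_S` for symmetric tensors).
Users take `(h : CHILO2018_rank_le_waringRank)`.
[cite: ChiantiniHauensteinIkenmeyerLandsbergOttaviani2018, §2 (proof of (1.6), p. 5)] -/
def CHILO2018_rank_le_waringRank : Prop :=
  ∀ n : ℕ, tensorRank (matMulTensor ℂ n n n) ≤ waringRankTrCube (3 * n)

/-- NAMED FACT — small case `R_S(sM⟨2⟩) = 6` (Chiantini et al. 2018, Thm. 1.3(1), citing
Segre and Landsberg–Teitler Prop. 7.2). Users take `(h : CHILO2018_waringRank_two)`.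
[cite: ChiantiniHauensteinIkenmeyerLandsbergOttaviani2018, Thm. 1.3(1)] -/
def CHILO2018_waringRank_two : Prop :=
  waringRankTrCube 2 = 6

/-! ## API -/

/-- A Waring decomposition of length `r` bounds the Waring rank by `r`. [folklore] -/
theorem waringRankTrCube_le {n r : ℕ} (L : Fin r → Matrix (Fin n) (Fin n) ℂ)
    (h : ∀ A : Matrix (Fin n) (Fin n) ℂ, (A ^ 3).trace = ∑ i, ((L i * A).trace) ^ 3) :
    waringRankTrCube n ≤ r :=
  Nat.sInf_le ⟨L, h⟩

/-- The polarisation bridge in the item's `∀ r` form: a length-`r` Waring decomposition of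
`tr(X³)` on `M_{3n}(ℂ)` gives `R(⟨n,n,n⟩) ≤ r`.
[cite: ChiantiniHauensteinIkenmeyerLandsbergOttaviani2018, §2 (proof of (1.6), p. 5)] -/
theorem CHILO2018_rank_le_waringRank.of_decomposition (h : CHILO2018_rank_le_waringRank)
    (n r : ℕ) (hL : ∃ (L : Fin r → Matrix (Fin (3 * n)) (Fin (3 * n)) ℂ),
      ∀ X : Matrix (Fin (3 * n)) (Fin (3 * n)) ℂ, (X ^ 3).trace = ∑ i, ((L i * X).trace) ^ 3) :
    tensorRank (matMulTensor ℂ n n n) ≤ r := by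
  obtain ⟨L, hL⟩ := hL
  exact (h n).trans (waringRankTrCube_le L hL)

end Literature.Computability.AlgebraicComplexity

end
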